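import Literature.MathematicalPhysics.QuantumFieldTheory.PlaquetteWeightTorusSpecification
import Literature.MathematicalPhysics.QuantumLattice.LatticeFieldShellMarkov
import Literature.MathematicalPhysics.QuantumLattice.LatticeGaugeDLRProofs
import Literature.MathematicalPhysics.QuantumLattice.HeatKernelGroupGaugeProofs
import HarnessLib

/-!
# Venture YMGap — track (c) «DS», vertex-STAR window, GAUGE side of Lemma G (`GAUGE-STAR.md` §2, §3′)

HONEST FRAMING: venture file (cell `pub-ymgap`), strong-coupling LATTICE bookkeeping only. Measure-theoretic
identities for the torus weight specification `torusWeightSpec v` of a CLASS-FUNCTION plaquette weight `v`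
(any compact group, any torus `(ℤ/L)^d`), with NO estimate and NO number: `torusWeightSpec_map_gaugeTransform`
(GAUGE COVARIANCE `(γ_Λ(·|η)).map (U ↦ U^g) = γ_Λ(·|η^g)`: invariant energy + product Haar preserved +
gluing intertwines); `torusWeightSpec_map_gaugeAt` (INVARIANCE of every kernel whose volume contains the
vertex star of `s` under gauge transformations at `s`); `gaugeAvg s f` (Haar average over the gauge group at
`s`: measurable, same bound, same `DependsOn`, same per-link Lipschitz vector for bi-invariant weights,
invariant at `s`, same integral against every such kernel — so the window hypothesis (H1) of the
Dobrushin–Shlosman door need only be checked on observables invariant at the centre,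
`integral_sub_integral_eq_gaugeAvg`); `integral_torusWeightSpec_eq_erase` (FROZEN-LINK IDENTITY: for `f`
invariant at `s` and a star link `a ∈ Λ`, `∫ f dγ_Λ(·|η) = ∫ f dγ_{Λ∖{a}}(·|η^{a←1})`, by consistency,
covariance and properness).  Steps (3)–(4) of Lemma G (Föllmer's comparison on the remaining links,
`DobrushinComparisonDefect`) and `StarWindowBound` are NOT here; nothing is specific to `SU(2)` or `β`;
nothing about confinement, the continuum or the mass gap.  References: E. Seiler, LNP 159 (1982) Ch. 2;
H.-O. Georgii (2011) Def. 1.23, §5.2; S. Elitzur, Phys. Rev. D 12 (1975) 3978.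
-/

noncomputable section

open MeasureTheory Function Finset
open Literature.Probability.LatticeModels
open Literature.MathematicalPhysics.QuantumFieldTheory
open Literature.MathematicalPhysics.QuantumLattice (plaquetteHolonomy_gaugeTransform
  measurePreserving_mul_mul_inv_haarProbability integral_integral_eq_of_lintegral_eq)
open Literature.Probability.LatticeModels.DobrushinMetric (integrable_of_abs_le')

namespace Summit.Ventures.YMGap.StarGauge

section Algebra

variable {d L : ℕ} {G : Type*} [Group G]

/-- Gauge transformations compose: `(U^{g'})^{g} = U^{g g'}`. [folklore] -/
theorem gaugeTransform_gaugeTransform (g g' : Site d L → G) (U : GaugeConfig d L G) :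
    gaugeTransform g (gaugeTransform g' U) = gaugeTransform (g * g') U := by
  funext e
  simp only [gaugeTransform, Pi.mul_apply, mul_inv_rev, mul_assoc]

/-- A gauge transformation equal to `1` at both endpoints of a link does not move that link. [folklore] -/
theorem gaugeTransform_apply_of_eq_one {g : Site d L → G} {U : GaugeConfig d L G} {e : Edge d L}
    (h1 : g e.1 = 1) (h2 : g (e.1.shift e.2) = 1) : gaugeTransform g U e = U e := by simp [gaugeTransform, h1, h2]

/-- **A class-function plaquette weight has a gauge-invariant torus energy**:
`∑_q log v((U^g)_q) = ∑_q log v(U_q)` (each holonomy is conjugated, `plaquetteHolonomy_gaugeTransform`).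
[folklore] -/
theorem torusLogWeight_gaugeTransform [NeZero L] {v : G → ℝ} (hv : ∀ a b : G, v (a * b * a⁻¹) = v b)
    (g : Site d L → G) (U : GaugeConfig d L G) :
    torusLogWeight v (gaugeTransform g U) = torusLogWeight v U := by
  unfold torusLogWeight
  refine Finset.sum_congr rfl fun q _ => ?_
  rw [plaquetteHolonomy_gaugeTransform, hv]

/-- The gauge action restricted to the links of a volume `Λ` (acting on the inside data `ζ : Λ → G`).
[folklore] -/
def gaugeTransformOn (Λ : Finset (Edge d L)) (g : Site d L → G) (ζ : ↥Λ → G) : ↥Λ → G :=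
  fun e => g e.1.1 * ζ e * (g (e.1.1.shift e.1.2))⁻¹

/-- **Gluing intertwines the gauge actions**: `(ζ η_{Λᶜ})^g = (ζ^g) (η^g)_{Λᶜ}`. [folklore] -/
theorem gaugeTransform_glueWith (Λ : Finset (Edge d L)) (g : Site d L → G) (ζ : ↥Λ → G)
    (η : GaugeConfig d L G) :
    gaugeTransform g (glueWith Λ ζ η) = glueWith Λ (gaugeTransformOn Λ g ζ) (gaugeTransform g η) := by
  funext e
  by_cases he : e ∈ Λ
  · rw [glueWith_apply_mem _ _ _ he]
    simp only [gaugeTransform, gaugeTransformOn, glueWith_apply_mem _ _ _ he]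
  · rw [glueWith_apply_not_mem _ _ _ he]
    simp only [gaugeTransform, glueWith_apply_not_mem _ _ _ he]

/-- Gluing reads the outside configuration only off `Λ`. [folklore] -/
theorem glueWith_congr_off {S : Type*} (Λ : Finset (Edge d L)) (ζ : ↥Λ → S) {η η' : Edge d L → S}
    (h : ∀ e, e ∉ Λ → η e = η' e) : glueWith Λ ζ η = glueWith Λ ζ η' := by
  funext e
  by_cases he : e ∈ Λ
  · rw [glueWith_apply_mem _ _ _ he, glueWith_apply_mem _ _ _ he]
  · rw [glueWith_apply_not_mem _ _ _ he, glueWith_apply_not_mem _ _ _ he, h e he]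

/-- The gauge transformation by `g` at the single vertex `s` (and `1` elsewhere). [folklore] -/
def gaugeAt (s : Site d L) (g : G) : Site d L → G := Pi.mulSingle s g

/-- `gaugeAt s g` is `g` at `s`. [folklore] -/
@[simp] theorem gaugeAt_self (s : Site d L) (g : G) : gaugeAt s g s = g := by simp [gaugeAt]

/-- `gaugeAt s g` is `1` away from `s`. [folklore] -/
theorem gaugeAt_of_ne {s x : Site d L} (g : G) (h : x ≠ s) : gaugeAt s g x = 1 := by
  simp [gaugeAt, h]

/-- Gauge transformations at one vertex multiply: `gaugeAt s g * gaugeAt s h = gaugeAt s (g h)`. [folklore] -/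
theorem gaugeAt_mul (s : Site d L) (g h : G) : gaugeAt s g * gaugeAt s h = gaugeAt s (g * h) := by
  simp [gaugeAt, Pi.mulSingle_mul]

/-- **A gauge transformation at `s` moves only the links of the vertex star of `s`** (the links `e`
with `e.1 = s ∨ e.1.shift e.2 = s`, i.e. the cell's `DSWindow.vertexStar s`). [folklore] -/
theorem gaugeTransform_gaugeAt_apply_of_not_star {s : Site d L} (g : G)
    {U : GaugeConfig d L G} {e : Edge d L} (he : ¬ (e.1 = s ∨ e.1.shift e.2 = s)) :
    gaugeTransform (gaugeAt s g) U e = U e := by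
  rw [not_or] at he
  exact gaugeTransform_apply_of_eq_one (gaugeAt_of_ne g he.1) (gaugeAt_of_ne g he.2)

/-- On a torus of side `≥ 2` a link is not a loop: `x + e_μ ≠ x`. [folklore] -/
theorem shift_ne_self (hL : 1 < L) (x : Site d L) (μ : Fin d) : x.shift μ ≠ x := by
  intro h
  have h1 : (x.shift μ) μ = x μ := by rw [h]
  simp only [Literature.MathematicalPhysics.QuantumFieldTheory.Site.shift, Pi.add_apply,
    Pi.single_eq_same, add_eq_left] at h1
  haveI : Fact (1 < L) := ⟨hL⟩
  exact one_ne_zero h1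

/-- **A star link can be gauged to `1` from the centre**: for `a` in the vertex star of `s` (torus side
`≥ 2`) and any configuration `U` there is `g` with `(U^{g at s})_a = 1`. [folklore] -/
theorem exists_gaugeAt_apply_eq_one (hL : 1 < L) {s : Site d L} {a : Edge d L}
    (ha : a.1 = s ∨ a.1.shift a.2 = s) (U : GaugeConfig d L G) :
    ∃ g : G, gaugeTransform (gaugeAt s g) U a = 1 := by
  by_cases h1 : a.1 = s
  · -- outgoing link: `(U^g)_a = g U_a`, take `g = U_a⁻¹`
    refine ⟨(U a)⁻¹, ?_⟩
    have h2 : a.1.shift a.2 ≠ s := by rw [← h1]; exact shift_ne_self hL a.1 a.2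
    have e1 : gaugeAt s (U a)⁻¹ a.1 = (U a)⁻¹ := by rw [h1, gaugeAt_self]
    rw [gaugeTransform, e1, gaugeAt_of_ne _ h2, inv_one, mul_one, inv_mul_cancel]
  · -- incoming link: `(U^g)_a = U_a g⁻¹`, take `g = U_a`
    have h2 : a.1.shift a.2 = s := ha.resolve_left h1
    refine ⟨U a, ?_⟩
    have e2 : gaugeAt s (U a) (a.1.shift a.2) = U a := by rw [h2, gaugeAt_self]
    rw [gaugeTransform, gaugeAt_of_ne _ h1, one_mul, e2, mul_inv_cancel]

end Algebra

section MeasureTheory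

variable {d L : ℕ} [NeZero L] {G : Type*} [Group G] [TopologicalSpace G] [IsTopologicalGroup G]
  [CompactSpace G] [MeasurableSpace G] [BorelSpace G] [SecondCountableTopology G]

omit [SecondCountableTopology G] in
/-- **The kernel reads the boundary condition only off `Λ`**: `γ_Λ(· | η) = γ_Λ(· | η')` if `η = η'`
off `Λ`. [folklore] -/
theorem torusWeightSpec_congr_off (v : G → ℝ) (Λ : Finset (Edge d L))
    {η η' : GaugeConfig d L G} (h : ∀ e, e ∉ Λ → η e = η' e) :
    torusWeightSpec v Λ η = torusWeightSpec v Λ η' := by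
  unfold torusWeightSpec
  have hfun : (fun ζ : ↥Λ → G => glueWith Λ ζ η) = fun ζ => glueWith Λ ζ η' :=
    funext fun ζ => glueWith_congr_off Λ ζ h
  rw [hfun]

omit [NeZero L] [SecondCountableTopology G] in
/-- The restricted gauge action preserves product Haar measure on the links of `Λ` (link by link a
two-sided translation, `measurePreserving_mul_mul_inv_haarProbability`; Mathlib `measurePreserving_pi`).
[folklore] -/
theorem measurePreserving_gaugeTransformOn (Λ : Finset (Edge d L)) (g : Site d L → G) :
    MeasurePreserving (gaugeTransformOn Λ g)
      (Measure.pi fun _ : ↥Λ => haarProbability G) (Measure.pi fun _ : ↥Λ => haarProbability G) :=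
  measurePreserving_pi (f := fun (e : ↥Λ) (x : G) => g e.1.1 * x * (g (e.1.1.shift e.1.2))⁻¹)
    (fun _ : ↥Λ => haarProbability G) (fun _ : ↥Λ => haarProbability G)
    fun e => measurePreserving_mul_mul_inv_haarProbability (g e.1.1) (g (e.1.1.shift e.1.2))

omit [NeZero L] [CompactSpace G] in
/-- Gauge transformations of the torus configuration space are measurable. [folklore] -/
@[fun_prop]
theorem measurable_gaugeTransform (g : Site d L → G) :
    Measurable (gaugeTransform g : GaugeConfig d L G → GaugeConfig d L G) := by
  refine measurable_pi_lambda _ fun e => ?_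
  exact ((measurable_const.mul (measurable_pi_apply e)).mul measurable_const)

/-- **GAUGE COVARIANCE OF THE TORUS WEIGHT SPECIFICATION** (class-function, continuous plaquette weight):
`(γ_Λ(· | η)).map (U ↦ U^g) = γ_Λ(· | η^g)` — invariant energy (`map_tilted_comp`), product Haar measure
preserved on `Λ`, gluing intertwines (Georgii 2011 §5.2; Seiler LNP 159 Ch. 2). [folklore] -/
theorem torusWeightSpec_map_gaugeTransform {v : G → ℝ}
    (hvc : Continuous v) (hv : ∀ a b : G, v (a * b * a⁻¹) = v b) (Λ : Finset (Edge d L))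
    (g : Site d L → G) (η : GaugeConfig d L G) :
    (torusWeightSpec v Λ η).map (gaugeTransform g) = torusWeightSpec v Λ (gaugeTransform g η) := by
  have hW : Measurable (torusLogWeight (d := d) (L := L) v) := measurable_torusLogWeight hvc
  have hT : Measurable (gaugeTransform g : GaugeConfig d L G → GaugeConfig d L G) :=
    measurable_gaugeTransform g
  have hinv : (torusLogWeight (d := d) (L := L) v) ∘ gaugeTransform g = torusLogWeight v :=
    funext fun U => torusLogWeight_gaugeTransform hv g U
  unfold torusWeightSpec
  set μ : Measure (GaugeConfig d L G) :=
    (Measure.pi fun _ : ↥Λ => haarProbability G).map (glueWith Λ · η) with hμ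
  -- tilt and push-forward commute because the energy is invariant
  have h1 : (μ.tilted (torusLogWeight v)).map (gaugeTransform g) =
      (μ.map (gaugeTransform g)).tilted (torusLogWeight v) := by
    conv_lhs => rw [← hinv]
    exact map_tilted_comp μ hT hW
  rw [h1]
  congr 1
  -- the glued product Haar measure is gauge covariant
  rw [hμ, Measure.map_map hT (measurable_glueWith Λ η)]
  have hcomp : (gaugeTransform g ∘ fun ζ : ↥Λ → G => glueWith Λ ζ η) =
      (fun ζ : ↥Λ → G => glueWith Λ ζ (gaugeTransform g η)) ∘ gaugeTransformOn Λ g :=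
    funext fun ζ => gaugeTransform_glueWith Λ g ζ η
  rw [hcomp, ← Measure.map_map (measurable_glueWith Λ _) (measurePreserving_gaugeTransformOn Λ g).measurable,
    (measurePreserving_gaugeTransformOn Λ g).map_eq]

/-- **INVARIANCE OF THE STAR KERNEL.** If `Λ` contains the vertex star of `s`, the kernel `γ_Λ(· | η)`
of a class-function plaquette weight is invariant under the gauge transformations at `s`:
`(γ_Λ(· | η)).map (U ↦ U^{g at s}) = γ_Λ(· | η)`. [folklore] -/
theorem torusWeightSpec_map_gaugeAt {v : G → ℝ}
    (hvc : Continuous v) (hv : ∀ a b : G, v (a * b * a⁻¹) = v b) {Λ : Finset (Edge d L)}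
    {s : Site d L} (hΛ : ∀ e : Edge d L, (e.1 = s ∨ e.1.shift e.2 = s) → e ∈ Λ) (g : G) (η : GaugeConfig d L G) :
    (torusWeightSpec v Λ η).map (gaugeTransform (gaugeAt s g)) = torusWeightSpec v Λ η := by
  rw [torusWeightSpec_map_gaugeTransform hvc hv Λ (gaugeAt s g) η]
  exact torusWeightSpec_congr_off v Λ fun e he =>
    gaugeTransform_gaugeAt_apply_of_not_star g fun hes => he (hΛ e hes)

/-- **The gauge average at `s`**: `(gaugeAvg s f)(U) = ∫_G f(U^{g at s}) dg` (normalised Haar measure).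
[folklore] -/
def gaugeAvg (s : Site d L) (f : GaugeConfig d L G → ℝ) (U : GaugeConfig d L G) : ℝ :=
  ∫ g, f (gaugeTransform (gaugeAt s g) U) ∂haarProbability G

omit [NeZero L] [CompactSpace G] [MeasurableSpace G] [BorelSpace G] [SecondCountableTopology G] in
/-- The gauge action `(g, U) ↦ U^{g at s}` is jointly continuous. [folklore] -/
theorem continuous_gaugeActionAt (s : Site d L) :
    Continuous fun p : G × GaugeConfig d L G => gaugeTransform (gaugeAt s p.1) p.2 := by
  have hpt : ∀ x : Site d L, Continuous fun p : G × GaugeConfig d L G => gaugeAt s p.1 x := by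
    intro x
    by_cases hx : x = s
    · subst hx
      simp only [gaugeAt_self]
      exact continuous_fst
    · simp only [gaugeAt_of_ne _ hx]
      exact continuous_const
  refine continuous_pi fun e => ?_
  simp only [gaugeTransform]
  exact ((hpt _).mul ((continuous_apply e).comp continuous_snd)).mul (hpt _).inv

omit [CompactSpace G] in
/-- Joint measurability of `(U, g) ↦ f(U^{g at s})` for measurable `f`. [folklore] -/
theorem measurable_uncurry_gaugeActionAt (s : Site d L) {f : GaugeConfig d L G → ℝ}
    (hf : Measurable f) :
    Measurable (uncurry fun (U : GaugeConfig d L G) (g : G) => f (gaugeTransform (gaugeAt s g) U)) := by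
  have hc : Continuous fun p : GaugeConfig d L G × G => gaugeTransform (gaugeAt s p.2) p.1 :=
    (continuous_gaugeActionAt s).comp (continuous_swap)
  exact hf.comp hc.measurable

/-- The gauge average of a measurable observable is measurable. [folklore] -/
theorem measurable_gaugeAvg (s : Site d L) {f : GaugeConfig d L G → ℝ} (hf : Measurable f) :
    Measurable (gaugeAvg (d := d) (L := L) s f) := by
  have h := (measurable_uncurry_gaugeActionAt s hf).stronglyMeasurable.integral_prod_right
    (ν := haarProbability G)
  exact h.measurable

omit [NeZero L] [SecondCountableTopology G] in
/-- The gauge average of an observable bounded by `M` is bounded by `M`. [folklore] -/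
theorem abs_gaugeAvg_le (s : Site d L) {f : GaugeConfig d L G → ℝ} {M : ℝ} (hM : ∀ U, |f U| ≤ M)
    (U : GaugeConfig d L G) : |gaugeAvg s f U| ≤ M := by
  unfold gaugeAvg
  have h := norm_integral_le_of_norm_le_const (μ := haarProbability G)
    (f := fun g : G => f (gaugeTransform (gaugeAt s g) U)) (C := M)
    (ae_of_all _ fun g => by rw [Real.norm_eq_abs]; exact hM _)
  simpa using h

omit [NeZero L] [SecondCountableTopology G] in
/-- The gauge average reads the same links as the observable. [folklore] -/
theorem dependsOn_gaugeAvg (s : Site d L) {f : GaugeConfig d L G → ℝ} {D : Set (Edge d L)}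
    (hf : DependsOn f D) : DependsOn (gaugeAvg s f) D := by
  intro U U' h
  unfold gaugeAvg
  refine integral_congr_ae (ae_of_all _ fun g => hf fun e he => ?_)
  simp only [gaugeTransform, h e he]

omit [NeZero L] [SecondCountableTopology G] in
/-- **The gauge average is invariant at `s`** (right invariance of Haar measure on the compact group).
[folklore] -/
theorem gaugeAvg_gaugeTransform_gaugeAt (s : Site d L) (f : GaugeConfig d L G → ℝ) (h : G)
    (U : GaugeConfig d L G) :
    gaugeAvg s f (gaugeTransform (gaugeAt s h) U) = gaugeAvg s f U := by
  unfold gaugeAvg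
  simp_rw [gaugeTransform_gaugeTransform, gaugeAt_mul]
  have hmp : MeasurePreserving (fun x : G => x * h) (haarProbability G) (haarProbability G) := by
    have h0 := measurePreserving_mul_mul_inv_haarProbability (G := G) 1 h⁻¹
    simpa using h0
  exact hmp.integral_comp (MeasurableEquiv.mulRight h).measurableEmbedding
    (fun x : G => f (gaugeTransform (gaugeAt s x) U))

/-- `g ↦ f(U^{g at s})` is Haar-integrable for bounded measurable `f`. [folklore] -/
theorem integrable_gaugeActionAt (s : Site d L) {f : GaugeConfig d L G → ℝ} (hfm : Measurable f) {M : ℝ}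
    (hM : ∀ U, |f U| ≤ M) (U : GaugeConfig d L G) :
    Integrable (fun g : G => f (gaugeTransform (gaugeAt s g) U)) (haarProbability G) :=
  Integrable.of_bound ((hfm.comp ((continuous_gaugeActionAt s).comp
    (continuous_id.prodMk continuous_const)).measurable).aestronglyMeasurable) M
    (ae_of_all _ fun g => by rw [Real.norm_eq_abs]; exact hM _)

/-- **The gauge average has the same per-link Lipschitz vector** for every link weight `r` that is
invariant under two-sided translations (e.g. the Frobenius distance on `SU(N)`). [folklore] -/
theorem lip_gaugeAvg (s : Site d L) {r : G → G → ℝ} (hr : ∀ a b x y : G, r (a * x * b) (a * y * b) = r x y)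
    {f : GaugeConfig d L G → ℝ} (hfm : Measurable f) {M : ℝ} (hM : ∀ U, |f U| ≤ M) {δ : Edge d L → ℝ}
    (hδ : ∀ (x : Edge d L) (σ τ : GaugeConfig d L G), (∀ e, e ≠ x → σ e = τ e) →
      |f σ - f τ| ≤ δ x * r (σ x) (τ x))
    (x : Edge d L) (σ τ : GaugeConfig d L G) (hστ : ∀ e, e ≠ x → σ e = τ e) :
    |gaugeAvg s f σ - gaugeAvg s f τ| ≤ δ x * r (σ x) (τ x) := by
  unfold gaugeAvg
  rw [← integral_sub (integrable_gaugeActionAt s hfm hM σ) (integrable_gaugeActionAt s hfm hM τ)]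
  have hpt : ∀ g : G, |f (gaugeTransform (gaugeAt s g) σ) - f (gaugeTransform (gaugeAt s g) τ)| ≤
      δ x * r (σ x) (τ x) := fun g => by
    have h := hδ x (gaugeTransform (gaugeAt s g) σ) (gaugeTransform (gaugeAt s g) τ) fun e he => by
      simp only [gaugeTransform, hστ e he]
    simpa only [gaugeTransform, hr] using h
  have h := norm_integral_le_of_norm_le_const (μ := haarProbability G)
    (f := fun g : G => f (gaugeTransform (gaugeAt s g) σ) - f (gaugeTransform (gaugeAt s g) τ))
    (C := δ x * r (σ x) (τ x)) (ae_of_all _ fun g => by rw [Real.norm_eq_abs]; exact hpt g)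
  simpa using h

/-- **Same integral against every star-containing kernel**: `∫ gaugeAvg s f dγ_Λ(· | η) = ∫ f dγ_Λ(· | η)`
(Fubini and `torusWeightSpec_map_gaugeAt`). [folklore] -/
theorem integral_gaugeAvg_torusWeightSpec [MeasurableSingletonClass G] {v : G → ℝ}
    (hvc : Continuous v) (hv0 : ∀ g, 0 < v g) (hv : ∀ a b : G, v (a * b * a⁻¹) = v b)
    {Λ : Finset (Edge d L)} {s : Site d L} (hΛ : ∀ e : Edge d L, (e.1 = s ∨ e.1.shift e.2 = s) → e ∈ Λ) (η : GaugeConfig d L G)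
    {f : GaugeConfig d L G → ℝ} (hfm : Measurable f) {M : ℝ} (hM : ∀ U, |f U| ≤ M) :
    ∫ U, gaugeAvg s f U ∂(torusWeightSpec v Λ η) = ∫ U, f U ∂(torusWeightSpec v Λ η) := by
  haveI := (isSpecification_torusWeightSpec (d := d) (L := L) hvc hv0).isProbability Λ η
  set μ := torusWeightSpec (d := d) (L := L) v Λ η with hμ
  -- Fubini
  have hint : Integrable (uncurry fun (U : GaugeConfig d L G) (g : G) => f (gaugeTransform (gaugeAt s g) U))
      (μ.prod (haarProbability G)) :=
    Integrable.of_bound (measurable_uncurry_gaugeActionAt s hfm).aestronglyMeasurable M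
      (ae_of_all _ fun p => by rw [Real.norm_eq_abs]; exact hM _)
  have hswap := integral_integral_swap hint
  unfold gaugeAvg
  rw [hswap]
  -- each inner integral is `∫ f dμ` by invariance of the kernel
  have hinner : ∀ g : G, ∫ U, f (gaugeTransform (gaugeAt s g) U) ∂μ = ∫ U, f U ∂μ := fun g => by
    rw [← integral_map (measurable_gaugeTransform (gaugeAt s g)).aemeasurable hfm.aestronglyMeasurable,
      hμ, torusWeightSpec_map_gaugeAt hvc hv hΛ g η]
  simp_rw [hinner]
  simp

/-- **REDUCTION OF (H1) TO INVARIANT OBSERVABLES**: the difference of two star-containing kernel integrals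
of `f` equals that of its gauge average at `s`. [folklore] -/
theorem integral_sub_integral_eq_gaugeAvg [MeasurableSingletonClass G] {v : G → ℝ}
    (hvc : Continuous v) (hv0 : ∀ g, 0 < v g) (hv : ∀ a b : G, v (a * b * a⁻¹) = v b)
    {Λ : Finset (Edge d L)} {s : Site d L} (hΛ : ∀ e : Edge d L, (e.1 = s ∨ e.1.shift e.2 = s) → e ∈ Λ) (ω η : GaugeConfig d L G)
    {f : GaugeConfig d L G → ℝ} (hfm : Measurable f) {M : ℝ} (hM : ∀ U, |f U| ≤ M) :
    ∫ U, f U ∂(torusWeightSpec v Λ ω) - ∫ U, f U ∂(torusWeightSpec v Λ η) =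
      ∫ U, gaugeAvg s f U ∂(torusWeightSpec v Λ ω) - ∫ U, gaugeAvg s f U ∂(torusWeightSpec v Λ η) := by
  rw [integral_gaugeAvg_torusWeightSpec hvc hv0 hv hΛ ω hfm hM,
    integral_gaugeAvg_torusWeightSpec hvc hv0 hv hΛ η hfm hM]

/-- **THE FROZEN-LINK IDENTITY.** For a continuous positive class-function plaquette weight, a volume `Λ`
containing the vertex star of `s`, a star link `a`, torus side `≥ 2` and a bounded measurable `f` invariant
under the gauge transformations at `s`: `∫ f dγ_Λ(· | η) = ∫ f dγ_{Λ∖{a}}(· | η^{a ← 1})` (the link `a`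
FROZEN to `1`). Proof: consistency `γ_Λ f = γ_Λ(γ_{Λ∖{a}} f)`; by covariance and invariance of `f` the inner
integral is unchanged when `σ_a` is gauged to `1`; properness. [folklore] -/
theorem integral_torusWeightSpec_eq_erase [MeasurableSingletonClass G] {v : G → ℝ}
    (hvc : Continuous v) (hv0 : ∀ g, 0 < v g) (hv : ∀ a b : G, v (a * b * a⁻¹) = v b) (hL : 1 < L)
    {Λ : Finset (Edge d L)} {s : Site d L} (hΛ : ∀ e : Edge d L, (e.1 = s ∨ e.1.shift e.2 = s) → e ∈ Λ) {a : Edge d L}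
    (ha : a.1 = s ∨ a.1.shift a.2 = s) (η : GaugeConfig d L G) {f : GaugeConfig d L G → ℝ} (hfm : Measurable f)
    {M : ℝ} (hM : ∀ U, |f U| ≤ M) (hfinv : ∀ (g : G) (U : GaugeConfig d L G),
      f (gaugeTransform (gaugeAt s g) U) = f U) :
    ∫ U, f U ∂(torusWeightSpec v Λ η) =
      ∫ U, f U ∂(torusWeightSpec v (Λ.erase a) (Function.update η a 1)) := by
  classical
  have hγ := isSpecification_torusWeightSpec (d := d) (L := L) hvc hv0
  haveI := hγ.isProbability Λ η
  have haΛ : a ∈ Λ := hΛ a ha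
  -- consistency: `γ_Λ f = γ_Λ (γ_{Λ∖{a}} f)`
  have hcons : ∫ σ, ∫ U, f U ∂(torusWeightSpec v (Λ.erase a) σ) ∂(torusWeightSpec v Λ η) =
      ∫ U, f U ∂(torusWeightSpec v Λ η) :=
    integral_integral_eq_of_lintegral_eq hγ (Λ.erase a)
      (fun A hA => hγ.consistent (Finset.erase_subset a Λ) η A hA) (integrable_of_abs_le' hfm hM)
  rw [← hcons]
  -- the inner integral is a.e. constant
  have hkey : ∀ σ : GaugeConfig d L G, (∀ e, e ∉ Λ → σ e = η e) →
      ∫ U, f U ∂(torusWeightSpec v (Λ.erase a) σ) =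
        ∫ U, f U ∂(torusWeightSpec v (Λ.erase a) (Function.update η a 1)) := by
    intro σ hσ
    obtain ⟨g, hg⟩ := exists_gaugeAt_apply_eq_one (G := G) hL ha σ
    -- gauge `σ` at `s` so that the link `a` becomes `1`
    have h1 : ∫ U, f U ∂(torusWeightSpec v (Λ.erase a) σ) =
        ∫ U, f U ∂(torusWeightSpec v (Λ.erase a) (gaugeTransform (gaugeAt s g) σ)) := by
      rw [← torusWeightSpec_map_gaugeTransform hvc hv (Λ.erase a) (gaugeAt s g) σ,
        integral_map (measurable_gaugeTransform _).aemeasurable hfm.aestronglyMeasurable]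
      simp_rw [hfinv]
    rw [h1]
    refine congrArg (fun m => ∫ U, f U ∂m) (torusWeightSpec_congr_off v (Λ.erase a) fun e he => ?_)
    by_cases hea : e = a
    · subst hea
      rw [hg, Function.update_self]
    · have heΛ : e ∉ Λ := fun h => he (Finset.mem_erase.2 ⟨hea, h⟩)
      rw [Function.update_of_ne hea, gaugeTransform_gaugeAt_apply_of_not_star g fun h => heΛ (hΛ e h),
        hσ e heΛ]
  have hae : (fun σ => ∫ U, f U ∂(torusWeightSpec v (Λ.erase a) σ)) =ᵐ[torusWeightSpec v Λ η]
      fun _ => ∫ U, f U ∂(torusWeightSpec v (Λ.erase a) (Function.update η a 1)) := by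
    filter_upwards [hγ.proper Λ η] with σ hσ
    exact hkey σ hσ
  rw [integral_congr_ae hae, integral_const, smul_eq_mul]
  simp

end MeasureTheory

end Summit.Ventures.YMGap.StarGauge

end
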